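import Summits.MatrixMultiplication.Statement
import Summits.MatrixMultiplication.MatrixMultiplication.Theorems.AsymptoticSpectrumMonotone

/-!
# MatrixMultiplication / RectangularAlpha — monotonicity of `R(⟨n,m,n⟩)` in the middle dimension

Route `MatrixMultiplication/RectangularAlpha`, item `stmt-MatrixMultiplication-0609` (rank 4):
`m ≤ m' → R(⟨n,m,n⟩) ≤ R(⟨n,m',n⟩)` over any field (indeed any commutative semiring), by
zero-padding in the middle dimension: `⟨n,m,n⟩` is the restriction of `⟨n,m',n⟩` along
`Fin m ↪ Fin m'` on the second and third coordinate (Bläser 2013, §5), using the restriction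
lemma `tensorRank_comp_le` of `AsymptoticSpectrum/Monotone.lean`.
-/

noncomputable section

namespace Literature.CplxAlg

universe u

section MatMul

variable (K : Type u) [CommSemiring K]

/-- Zero-padding in the middle dimension: for `m ≤ m'`, `⟨n,m,n⟩` is the restriction of
`⟨n,m',n⟩` along `Fin m ↪ Fin m'` in the `X`- and `Y`-coordinates. [cite: Blaser2013, §5] -/
theorem matMulTensor_eq_comp_castLE_middle (n : ℕ) {m m' : ℕ} (h : m ≤ m') :
    Literature.Computability.AlgebraicComplexity.matMulTensor K n m n = fun a b c =>
      Literature.Computability.AlgebraicComplexity.matMulTensor K n m' n a (Prod.map id (Fin.castLE h) b) (Prod.map (Fin.castLE h) id c) := by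
  funext a b c
  simp [Literature.Computability.AlgebraicComplexity.matMulTensor, Prod.map, Fin.ext_iff]

/-- Monotonicity of the rank of rectangular matrix multiplication in the middle dimension,
`m ≤ m' → R(⟨n,m,n⟩) ≤ R(⟨n,m',n⟩)`, over any commutative semiring (Bläser 2013, §5;
zero-padding). [cite: Blaser2013, §5] -/
theorem tensorRank_matMulTensor_mono_middle (n : ℕ) {m m' : ℕ} (h : m ≤ m') :
    Literature.Computability.AlgebraicComplexity.tensorRank (Literature.Computability.AlgebraicComplexity.matMulTensor K n m n) ≤ Literature.Computability.AlgebraicComplexity.tensorRank (Literature.Computability.AlgebraicComplexity.matMulTensor K n m' n) := by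
  classical
  rw [matMulTensor_eq_comp_castLE_middle K n h]
  exact tensorRank_comp_le _ _ _ _ (exists_eq_sum_triad (Literature.Computability.AlgebraicComplexity.matMulTensor K n m' n))

/-- Settles `stmt-MatrixMultiplication-0609` (exact signature, fields): monotonicity in the middle
dimension, `m ≤ m' → R(⟨n,m,n⟩) ≤ R(⟨n,m',n⟩)`. [cite: Blaser2013, §5] -/
theorem tensorRank_matMulTensor_monotone_middle :
    ∀ (K : Type) [Field K] (n m m' : ℕ), m ≤ m' →
      Literature.Computability.AlgebraicComplexity.tensorRank (Literature.Computability.AlgebraicComplexity.matMulTensor K n m n) ≤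
        Literature.Computability.AlgebraicComplexity.tensorRank (Literature.Computability.AlgebraicComplexity.matMulTensor K n m' n) :=
  fun K _ n _ _ h => tensorRank_matMulTensor_mono_middle K n h

end MatMul

end Literature.CplxAlg
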